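import Literature.IUT.HodgeArakelov.AbsTopMonoidsNonVacuity
import Literature.IUT.HodgeArakelov.AbsTopMonoidsNonVacuityAug
import Literature.AnabelianGeometry.AbsoluteAnabelian.MonoAnalyticMonoidFunctoriality
import HarnessLib

/-!
# [IUTchII] Example 1.8: a GENUINE-mod-`ε` inhabitant of `AbsTopMonoids` — the `(*⊳)` / `(*TM⊳)` sides built from
# the [AbsTopIII] model monoids `𝒪_k̄^⊳` and THE lifts of isomorphisms of `G_k` (MERGE-MAP row B9, O^⊳ side)

S. Mochizuki, *Inter-universal Teichmüller theory II*, §1, Example 1.8 (i)–(iv), kurims manuscript pp. 35–39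
[claim: Mochizuki2012, status: disputed] (IUTchII §1 Ex 1.8, kurims pp.35-39): (ii) «functorial group-theoretic
algorithm `G ↦ (G ↷ O^⊳(G))`» ([AbsTopIII] Prop 5.8 (i) / Def 3.1), (iii) «the isomorphism `(G ↷ O^×(G)) ≅ (G* ↷ O^×(G*))`
induced by an isomorphism of topological groups `G ≅ G*`», (i)/(ii) «`(Π ↷ M_TM(Π)) ≅ (Π/Δ ↷ O^⊳(Π/Δ))`».
abc-iut cell, layer L6, MERGE-MAP row B9 (map abc-iut-L6-t7; owners of record abc-iut-L4-t2/L4-t3 — GO to this seat: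
abc-iut-L4-lead 2026-08-26T03:47:06Z, abc-iut-L6-lead §F v1.19b (3)); seat abc-iut-L6-t13 (gen 4).  PROOF-ONLY (no
`def`/`instance`/`structure`: the witness is built inside the theorem term; a def-level producer is the post-freeze
row «D-B9-genuine»).

WHAT IS GENUINE HERE (given a model identification `ε : G_k ≃ₜ* Gal(k̄/k)` of the setting's `G_k` with the Galois
group of an MLF closure datum `C = (k, k̄)`, abc-iut-L4-t2's `MLFClosure`):
* `O^⊳(G) := 𝒪_k̄^⊳` (`nonzeroIntegers k k̄`, the object of abc-iut-L4-t2's mono-analytic model `TM`-pair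
  `(ModelMLFGaloisData.galois k k̄).tmPair`), with `G` acting through a CHOSEN `G ≅ G_k` (the groupoid `IsoClass G_k`
  only records `Nonempty (G ≅ G_k)`) and `ε`;
* `O^⊳(f)` for `f : G ⥲ G*` := THE monoid component of the UNIQUE lift of the induced automorphism of `Gal(k̄/k)` to the
  model pair (`MLFClosure.existsUnique_tmPairLift`, abc-iut-L6-t13 p420298 — existence = F-0410
  `galoisIsoLiftsToTMPairIsoOfMonoAnalytic_holds` p418751 over abc-iut-L4-d3's `Prop121vii.unitsTransport_holds`,
  uniqueness = `pairIsoDeterminedByGalois_holds`): functor laws and equivariance hold BY UNIQUENESS;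
* `M_TM(Π) := O^⊳(Π/Δ)` with `(*TM⊳) := id` (print's tautological isomorphism is definitional), `Π` acting through
  `Π ↠ Π/Δ`, transports along `Π ≅ Π*` := `O^⊳` of the induced isomorphism of quotients;
* `Δ(Π*)`, `Π*/Δ* ≅ G_k`: abc-iut-w5-d114's transport plumbing (`AbsTopMonoids.chosenIso/deltaOf/quotDeltaOfIso`,
  p417411) under the SAME two hypotheses (H1) «`Δ` characteristic» / (H2) «`Π/Δ ≅ G_k`» that
  `AbsTopMonoids.nonempty_iff` shows NECESSARY for any inhabitant.
WHAT IS NOT (honest residual, = the remaining content of B9 / of abc-iut-w4-d030's NV-BLOCKED `GalRigidityInput`):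
the isometry group `Ism(G)` («the compact topological group of `G`-isometries of `O^{×μ}(G)`», Ex 1.8 (iv) p. 39) and
`Ẑ^× ↠ ℤ_p^× ↪ Ism(G)` are DEGENERATE here (`PUnit`, trivial maps): the genuine ones need the `ℤ_p`-module structure
of `𝒪_k̄^×/μ` (abc-iut-L6-d2's p-adic-log perfection bridge, B9 (c)).  HONEST FRAMING: record-only vocabulary under a
disputed claim key; the construction is classical ([AbsTopIII] + LCFT); nothing here bears on [IUTchIII] Cor. 3.12.
-/

noncomputable section

namespace Literature.IUT.HodgeArakelov

open CategoryTheory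
open Literature.AnabelianGeometry.AbsoluteAnabelian

namespace AbsTopMonoids

/-- **[IUTchII] Ex 1.8 — `AbsTopMonoids S` has a GENUINE-mod-`ε` inhabitant** (O^⊳/M_TM sides = the [AbsTopIII] model
monoids `𝒪_k̄^⊳` with their Galois action and THE lifted transports; `Ism` degenerate — see the module docstring),
for every setting `S` whose `G_k` is identified (`ε`) with the Galois group of an MLF closure datum `C` and which
satisfies the two NECESSARY conditions (H1) «`Δ ⊆ Π^tp_{X̲̲_k}` is carried onto itself by every automorphism»,
(H2) «`Π^tp_{X̲̲_k}/Δ ≅ G_k`» of `AbsTopMonoids.nonempty_iff`.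
[claim: Mochizuki2012, status: disputed] (IUTchII §1 Ex 1.8 (ii)-(iv), kurims pp.36-39) -/
theorem nonempty_genuine_of_modelIdentification (S : ThetaSetting.{0}) (C : MLFClosure.{0})
    (ε : S.Gk ≃ₜ* (ModelMLFGaloisData.galois C.k C.K).tmPair.Pi)
    (hΔ : ∀ f : S.PiX ≃ₜ* S.PiX, S.DeltaX.map f.toMulEquiv.toMonoidHom = S.DeltaX)
    (hq : Nonempty (TopGroup.quot S.PiX S.DeltaX ≃ₜ* S.Gk)) : Nonempty (AbsTopMonoids S) := by
  classical
  -- the model `TM`-pair `(Gal(k̄/k) ↷ 𝒪_k̄^⊳)` of mono-analytic type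
  let P₀ : GaloisMonoidPair.{0} := (ModelMLFGaloisData.galois C.k C.K).tmPair
  -- every isomorph `G` of `G_k` is identified with `Gal(k̄/k)`: a chosen `G ≅ G_k`, then `ε`
  let θ : ∀ G : IsoClass S.Gk, G.G ≃ₜ* P₀.Pi := fun G => (Classical.choice G.iso).trans ε
  -- THE lift of an automorphism of `Gal(k̄/k)` to the model pair ([AbsTopIII] Prop 3.2 (iv), F-0410 + injectivity)
  have hlift : ∀ φ : P₀.Pi ≃ₜ* P₀.Pi, ∃! ψ : P₀.M ≃* P₀.M, ∀ (σ : P₀.Pi) (x : P₀.M), ψ (σ • x) = φ σ • ψ x :=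
    fun φ => MLFClosure.existsUnique_tmPairLift C C φ
  let liftM : (P₀.Pi ≃ₜ* P₀.Pi) → (P₀.M ≃* P₀.M) := fun φ => (hlift φ).exists.choose
  have liftM_spec : ∀ (φ : P₀.Pi ≃ₜ* P₀.Pi) (σ : P₀.Pi) (x : P₀.M), liftM φ (σ • x) = φ σ • liftM φ x :=
    fun φ => (hlift φ).exists.choose_spec
  have liftM_unique : ∀ (φ : P₀.Pi ≃ₜ* P₀.Pi) (ψ : P₀.M ≃* P₀.M),
      (∀ (σ : P₀.Pi) (x : P₀.M), ψ (σ • x) = φ σ • ψ x) → ψ = liftM φ :=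
    fun φ ψ hψ => (hlift φ).unique hψ (liftM_spec φ)
  -- consequences of uniqueness: the lift only depends on the underlying function; functor laws
  have liftM_congr : ∀ φ φ' : P₀.Pi ≃ₜ* P₀.Pi, (∀ σ, φ σ = φ' σ) → liftM φ = liftM φ' := by
    intro φ φ' h
    refine liftM_unique φ' (liftM φ) fun σ x => ?_
    rw [liftM_spec, h]
  have liftM_refl : ∀ φ : P₀.Pi ≃ₜ* P₀.Pi, (∀ σ, φ σ = σ) → liftM φ = MulEquiv.refl _ := by
    intro φ h
    symm
    refine liftM_unique φ _ fun σ x => ?_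
    rw [h]; rfl
  have liftM_trans : ∀ φ₁ φ₂ φ : P₀.Pi ≃ₜ* P₀.Pi, (∀ σ, φ σ = φ₂ (φ₁ σ)) →
      liftM φ = (liftM φ₁).trans (liftM φ₂) := by
    intro φ₁ φ₂ φ h
    symm
    refine liftM_unique φ _ fun σ x => ?_
    rw [MulEquiv.trans_apply, liftM_spec, liftM_spec, MulEquiv.trans_apply, h]
  -- the induced automorphism of `Gal(k̄/k)` of a morphism `f : G ⟶ H` of `IsoClass G_k`
  let φOf : ∀ {G H : IsoClass S.Gk}, (G ⟶ H) → (P₀.Pi ≃ₜ* P₀.Pi) :=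
    fun {G H} f => ((θ G).symm.trans (IsoClass.homIso f)).trans (θ H)
  -- the `Π`-side: quotient objects `Π*/Δ*` of `IsoClass G_k` and the induced isomorphisms of quotients
  let qI : ∀ P : IsoClass S.PiX, Nonempty (TopGroup.quot P.G (deltaOf P) ≃ₜ* S.Gk) :=
    fun P => ⟨(quotDeltaOfIso P).trans (Classical.choice hq)⟩
  let QObj : IsoClass S.PiX → IsoClass S.Gk := fun P => ⟨TopGroup.quot P.G (deltaOf P), qI P⟩
  have hmapΔ : ∀ {P Q : IsoClass S.PiX} (f : P ⟶ Q),
      (deltaOf P).map (IsoClass.homIso f).toMulEquiv = deltaOf Q := fun f => by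
    have h := deltaOf_map hΔ f
    exact h
  let qMap : ∀ {P Q : IsoClass S.PiX}, (P ⟶ Q) → (QObj P ⟶ QObj Q) := fun {P Q} f =>
    { toMulEquiv := QuotientGroup.congr (deltaOf P) (deltaOf Q) (IsoClass.homIso f).toMulEquiv (hmapΔ f)
      continuous_toFun := by
        refine (QuotientGroup.isQuotientMap_mk (deltaOf P)).continuous_iff.2 ?_
        exact QuotientGroup.continuous_mk.comp (IsoClass.homIso f).continuous
      continuous_invFun := by
        refine (QuotientGroup.isQuotientMap_mk (deltaOf Q)).continuous_iff.2 ?_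
        exact QuotientGroup.continuous_mk.comp (IsoClass.homIso f).symm.continuous }
  have qMap_mk : ∀ {P Q : IsoClass S.PiX} (f : P ⟶ Q) (x : P.G),
      IsoClass.homIso (qMap f) (QuotientGroup.mk x : TopGroup.quot P.G (deltaOf P)) =
        (QuotientGroup.mk (IsoClass.homIso f x) : TopGroup.quot Q.G (deltaOf Q)) := fun f x => rfl
  refine ⟨{
    Otri := fun _ => P₀.M
    actOtri := fun G => (MulDistribMulAction.toMulAut P₀.Pi P₀.M).comp (θ G).toMulEquiv.toMonoidHom
    mapOtri := fun f => liftM (φOf f)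
    mapOtri_id := fun G => liftM_refl _ fun σ => by
      show θ G (IsoClass.homIso (𝟙 G) ((θ G).symm σ)) = σ
      exact (θ G).apply_symm_apply σ
    mapOtri_comp := fun f g => liftM_trans (φOf f) (φOf g) _ fun σ => by
      show θ _ (IsoClass.homIso (f ≫ g) ((θ _).symm σ)) = θ _ (IsoClass.homIso g ((θ _).symm (θ _ (IsoClass.homIso f ((θ _).symm σ)))))
      rw [ContinuousMulEquiv.symm_apply_apply]
      rfl
    mapOtri_equivariant := fun {G H} f g m => by
      show liftM (φOf f) (θ G g • m) = θ H (IsoClass.homIso f g) • liftM (φOf f) m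
      rw [liftM_spec]
      show θ H (IsoClass.homIso f ((θ G).symm (θ G g))) • _ = _
      rw [ContinuousMulEquiv.symm_apply_apply]
    MTM := fun _ => P₀.M
    actMTM := fun P => ((MulDistribMulAction.toMulAut P₀.Pi P₀.M).comp (θ (QObj P)).toMulEquiv.toMonoidHom).comp
      (QuotientGroup.mk' (deltaOf P))
    mapMTM := fun f => liftM (φOf (qMap f))
    mapMTM_id := fun P => liftM_refl _ fun σ => by
      show θ (QObj P) (IsoClass.homIso (qMap (𝟙 P)) ((θ (QObj P)).symm σ)) = σ
      have h : ∀ q : TopGroup.quot P.G (deltaOf P), IsoClass.homIso (qMap (𝟙 P)) q = q := by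
        intro q
        induction q using QuotientGroup.induction_on with
        | H x => rfl
      rw [h, ContinuousMulEquiv.apply_symm_apply]
    mapMTM_comp := fun {P Q R} f g => liftM_trans (φOf (qMap f)) (φOf (qMap g)) _ fun σ => by
      show θ (QObj R) (IsoClass.homIso (qMap (f ≫ g)) ((θ (QObj P)).symm σ)) =
        θ (QObj R) (IsoClass.homIso (qMap g) ((θ (QObj Q)).symm (θ (QObj Q)
          (IsoClass.homIso (qMap f) ((θ (QObj P)).symm σ)))))
      rw [ContinuousMulEquiv.symm_apply_apply]
      congr 1
      generalize (θ (QObj P)).symm σ = q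
      induction q using QuotientGroup.induction_on with
      | H x => rfl
    mapMTM_equivariant := fun {P Q} f x m => by
      show liftM (φOf (qMap f)) (θ (QObj P) (QuotientGroup.mk x) • m) =
        θ (QObj Q) (QuotientGroup.mk (IsoClass.homIso f x)) • liftM (φOf (qMap f)) m
      rw [liftM_spec]
      show θ (QObj Q) (IsoClass.homIso (qMap f) ((θ (QObj P)).symm (θ (QObj P) (QuotientGroup.mk x)))) • _ = _
      rw [ContinuousMulEquiv.symm_apply_apply, qMap_mk]
    Delta := fun P => deltaOf P
    Delta_map := fun f => deltaOf_map hΔ f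
    Delta_base := deltaOf_base hΔ
    quotIso := qI
    tauto := fun _ => MulEquiv.refl _
    tauto_equivariant := fun _ _ _ => rfl
    Ism := fun _ => PUnit
    actIsm := fun _ => 1
    toIsm := fun _ => 1 }⟩

/-- The same for settings with an OPEN augmentation `Π^tp_{X̲̲_k} ↠ G_k` (then (H2) is automatic — abc-iut-w5-d105's
`quotDeltaX_iso_of_isOpenMap`, the topological first isomorphism theorem): a GENUINE-mod-`ε` `AbsTopMonoids S` exists
as soon as `G_k` is identified with the Galois group of an MLF closure datum and `Δ` is characteristic (H1).
[claim: Mochizuki2012, status: disputed] (IUTchII §1 Ex 1.8 (ii)-(iv), kurims pp.36-39) -/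
theorem nonempty_genuine_of_isOpenMap (S : ThetaSetting.{0}) (C : MLFClosure.{0})
    (ε : S.Gk ≃ₜ* (ModelMLFGaloisData.galois C.k C.K).tmPair.Pi)
    (hΔ : ∀ f : S.PiX ≃ₜ* S.PiX, S.DeltaX.map f.toMulEquiv.toMonoidHom = S.DeltaX)
    (hopen : IsOpenMap S.aug) : Nonempty (AbsTopMonoids S) :=
  nonempty_genuine_of_modelIdentification S C ε hΔ (quotDeltaX_iso_of_isOpenMap S hopen)

/-- … and for settings with COMPACT `Π` and Hausdorff `G_k` (profinite étale `π₁`; (H2) by abc-iut-w5-d105's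
`quotDeltaX_iso_of_compactSpace`). [claim: Mochizuki2012, status: disputed] (IUTchII §1 Ex 1.8 (ii)-(iv), kurims pp.36-39) -/
theorem nonempty_genuine_of_compactSpace (S : ThetaSetting.{0}) [CompactSpace S.PiX] [T2Space S.Gk]
    (C : MLFClosure.{0}) (ε : S.Gk ≃ₜ* (ModelMLFGaloisData.galois C.k C.K).tmPair.Pi)
    (hΔ : ∀ f : S.PiX ≃ₜ* S.PiX, S.DeltaX.map f.toMulEquiv.toMonoidHom = S.DeltaX) : Nonempty (AbsTopMonoids S) :=
  nonempty_genuine_of_modelIdentification S C ε hΔ (quotDeltaX_iso_of_compactSpace S)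

end AbsTopMonoids

end Literature.IUT.HodgeArakelov

end
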